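import Mathlib
import Summits.ValiantsHypothesis.ValiantsHypothesis.Theorems.GrenetZeonHessianRankCodimTwoCharPTransfer
import Summits.ValiantsHypothesis.ValiantsHypothesis.Theorems.GrenetZeonHessianRankCodimTwoBorderFrobeniusEval
import Summits.ValiantsHypothesis.ValiantsHypothesis.Theorems.GrenetZeonHessianRankCodimTwoBorderBlockTable
import Summits.ValiantsHypothesis.ValiantsHypothesis.Theorems.GrenetZeonHessianRankCodimTwoBorderPrimeWindow
import HarnessLib

/-!
# Crux `GrenetZeon.HessianRankCodimTwo` (stmt-ValiantsHypothesis-8061), line `good_plane`,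
# stub `stub_goodPlanes` (all large `n`): ASSEMBLY of the bordered Latin plane (file 7 of
# `BorderedLatinAllN.md` §5, interface `BorderInterfaces.md` §3)

For `n = 3p + r` (`p` prime, `1 ≤ r ≤ p - 3`) the core non-vanishing `(★★)` `BordCoreNonvanishing p r`
("at every point of the bordered Latin plane on the permanental hypersurface at least five of the nine
core block values are non-zero", `…BorderDefs.lean`) follows from three inputs:

* (TABLE, LANDED, val-width-8061-p1 g2) on the plane, `per = 0 ⟹ Φ(a) = 0`
  (`eval_perPoly_bordPoint_eq_zero_iff_bordPhi`, `…BorderTable.lean`) and `h_{IJ}(a) = 0 ⟹ Ψ_{IJ}(a) = 0`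
  (`bordBlockValue_eq_zero_iff_bordPsi`, `…BorderBlockTable.lean`);
* (CONGRUENCES, LANDED, `…BorderFrobeniusEval.lean`) over a field of characteristic `p`:
  `Φ(w) = 0 ⟹ F(w) = 0 ∨ W(w) = 0` (`curve_of_aeval_bordPhi_eq_zero`) and `Ψ_{IJ}(w) = 0 ⟹ DEAD(I,J)`
  (`dead_of_aeval_bordPsi_eq_zero`: `P_d(w) = 0 ∨ w_d = 0 ∨ w_d W = U_I V_J ∨ w_d W = (r+1)·U_I V_J`, `d = J - I`);
* (DEATHS, val-width-8061-p3 g2, `…BorderDeaths`; hypothesis `hD` here in the literal shape of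
  `BorderInterfaces.md` §2) over a field of characteristic `p`, at a point `x ≠ 0` of the curve
  `F = 0 ∨ W = 0`, at most FOUR of the nine pairs `(I, J)` are dead (for any `c ≠ 0` in place of `r+1`).

`bordCoreNonvanishing_of_deaths` does the assembly: reduce the common zero of `Φ` and the vanishing
`Ψ_{IJ}` modulo `p` (`le_card_ne_zero_of_charP`, `…CharPTransfer.lean`, homogeneity from
`…BorderFrobeniusEval.lean`), read the congruences, count `9 - 4 = 5`.  `goodPlanes_of_deaths` then feeds
p3's `goodPlanes_of_bordCoreNonvanishing'` (`…BorderPrimeWindow.lean`): GIVEN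
the death count for all large primes, `GoodPlane n` holds for all large `n` — the registered stub
`stub_goodPlanes`, unfolded.  The one remaining hypothesis `hD` is exactly what `…BorderDeaths` (p3) +
`…BorderCert*` (lead) are landing; the unconditional `bordCoreNonvanishing_of_large_prime` of
`BorderInterfaces.md` §3 is then a short instantiation.  VP ≠ VNP is not moved by anything here (the crux feeds only the
constant-factor bound `TwoDimCoefficients`).
-/

noncomputable section

open MvPolynomial Finset
open Literature.Computability.AlgebraicComplexity

-- single-conjunct layout `Summits/ValiantsHypothesis/ValiantsHypothesis`: duplicated namespace by design
set_option linter.dupNamespace false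

namespace Summit.ValiantsHypothesis.ValiantsHypothesis.Theorems.GrenetZeonHessianRankCodimTwo

section Assembly

variable {p r : ℕ}

/-- **Characteristic-`p` count ⟹ five live forms.**  Over a field `L` of characteristic `p`
(`p` prime, `1 ≤ r ≤ p - 3`): if at every `x ≠ 0` on the curve `F = 0 ∨ W = 0` at most four pairs are
dead (hypothesis `hD`, the shape of `bord_deaths_le_four` with `c := r + 1`), then at every `w ≠ 0` with
`Φ(w) = 0` at least five of the nine `Ψ_{IJ}(w)` are non-zero. [folklore] -/
theorem five_le_card_aeval_bordPsi_ne_zero (hp : p.Prime) (hr1 : 1 ≤ r) (hr : r + 3 ≤ p)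
    {L : Type*} [Field L] [CharP L p] [DecidableEq L]
    (hD : ∀ (c : L), c ≠ 0 → ∀ x : Fin 3 → L, x ≠ 0 →
        (x 0 ^ 3 + x 1 ^ 3 + x 2 ^ 3 + 3 * (x 0 * x 1 * x 2) = 0 ∨ aeval x (bordEnt ℤ none none) = 0) →
        (Finset.univ.filter fun IJ : Fin 3 × Fin 3 =>
            (x (IJ.2 - IJ.1) = 0 ∨ x (IJ.2 - IJ.1) ^ 2 + x (IJ.2 - IJ.1 + 1) * x (IJ.2 - IJ.1 + 2) = 0) ∨
            x (IJ.2 - IJ.1) * aeval x (bordEnt ℤ none none) =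
              aeval x (bordEnt ℤ (some IJ.1) none) * aeval x (bordEnt ℤ none (some IJ.2)) ∨
            x (IJ.2 - IJ.1) * aeval x (bordEnt ℤ none none) =
              c * (aeval x (bordEnt ℤ (some IJ.1) none) * aeval x (bordEnt ℤ none (some IJ.2)))).card ≤ 4)
    (w : Fin 3 → L) (hw : w ≠ 0) (hΦw : aeval w (bordPhi ℤ p r) = 0) :
    5 ≤ (Finset.univ.filter fun IJ : Fin 3 × Fin 3 => aeval w (bordPsi ℤ p r IJ.1 IJ.2) ≠ 0).card := by
  classical
  haveI : Fact p.Prime := ⟨hp⟩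
  have hrp : r < p := by omega
  -- the curve
  have hcurve := curve_of_aeval_bordPhi_eq_zero p hrp w hΦw
  rw [← aeval_bordEnt_w w] at hcurve
  -- `c = r + 1 ≠ 0` in characteristic `p > r + 1`
  have hc : ((r + 1 : ℕ) : L) ≠ 0 := by
    intro h
    rw [CharP.cast_eq_zero_iff L p] at h
    have := Nat.le_of_dvd (by omega) h
    omega
  have hdead := hD ((r + 1 : ℕ) : L) hc w hw hcurve
  -- the vanishing `Ψ_{IJ}(w)` are dead pairs
  have hsub : (Finset.univ.filter fun IJ : Fin 3 × Fin 3 => aeval w (bordPsi ℤ p r IJ.1 IJ.2) = 0) ⊆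
      Finset.univ.filter fun IJ : Fin 3 × Fin 3 =>
        (w (IJ.2 - IJ.1) = 0 ∨ w (IJ.2 - IJ.1) ^ 2 + w (IJ.2 - IJ.1 + 1) * w (IJ.2 - IJ.1 + 2) = 0) ∨
        w (IJ.2 - IJ.1) * aeval w (bordEnt ℤ none none) =
          aeval w (bordEnt ℤ (some IJ.1) none) * aeval w (bordEnt ℤ none (some IJ.2)) ∨
        w (IJ.2 - IJ.1) * aeval w (bordEnt ℤ none none) =
          ((r + 1 : ℕ) : L) * (aeval w (bordEnt ℤ (some IJ.1) none) * aeval w (bordEnt ℤ none (some IJ.2))) := by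
    intro IJ hIJ
    simp only [Finset.mem_filter, Finset.mem_univ, true_and] at hIJ ⊢
    rcases dead_of_aeval_bordPsi_eq_zero p hr1 (by omega) w IJ.1 IJ.2 hIJ with h | h | h | h
    · exact Or.inl (Or.inr h)
    · exact Or.inl (Or.inl h)
    · exact Or.inr (Or.inl h)
    · exact Or.inr (Or.inr h)
  have hzero : (Finset.univ.filter fun IJ : Fin 3 × Fin 3 =>
      aeval w (bordPsi ℤ p r IJ.1 IJ.2) = 0).card ≤ 4 := (Finset.card_le_card hsub).trans hdead
  have hsplit := Finset.card_filter_add_card_filter_not (s := (Finset.univ : Finset (Fin 3 × Fin 3)))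
    (fun IJ : Fin 3 × Fin 3 => aeval w (bordPsi ℤ p r IJ.1 IJ.2) = 0)
  rw [Finset.card_univ, Fintype.card_prod, Fintype.card_fin] at hsplit
  have : (Finset.univ.filter fun IJ : Fin 3 × Fin 3 => ¬ aeval w (bordPsi ℤ p r IJ.1 IJ.2) = 0) =
      Finset.univ.filter fun IJ : Fin 3 × Fin 3 => aeval w (bordPsi ℤ p r IJ.1 IJ.2) ≠ 0 := rfl
  rw [this] at hsplit
  omega

/-- **ASSEMBLY `(★★)` from the death count.**  Let `p` be prime, `1 ≤ r ≤ p - 3`.  Suppose (DEATHS)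
that over every field of characteristic `p`, at every non-zero point of the curve `F = 0 ∨ W = 0`, at most
four of the nine pairs are dead (for every `c ≠ 0`).  Then `BordCoreNonvanishing p r`.  Proof: the table
identities (`eval_perPoly_bordPoint_eq_zero_iff_bordPhi`, `bordBlockValue_eq_zero_iff_bordPsi`) put `a`
on `Φ = 0` and the vanishing block values on `Ψ_{IJ} = 0`; reduce the common zero modulo `p`
(`le_card_ne_zero_of_charP`) and count with `five_le_card_aeval_bordPsi_ne_zero`. [folklore] -/
theorem bordCoreNonvanishing_of_deaths (hp : p.Prime) (hr1 : 1 ≤ r) (hr : r + 3 ≤ p)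
    (hD : ∀ (L : Type) [Field L] [CharP L p] [DecidableEq L] (c : L), c ≠ 0 → ∀ x : Fin 3 → L, x ≠ 0 →
        (x 0 ^ 3 + x 1 ^ 3 + x 2 ^ 3 + 3 * (x 0 * x 1 * x 2) = 0 ∨ aeval x (bordEnt ℤ none none) = 0) →
        (Finset.univ.filter fun IJ : Fin 3 × Fin 3 =>
            (x (IJ.2 - IJ.1) = 0 ∨ x (IJ.2 - IJ.1) ^ 2 + x (IJ.2 - IJ.1 + 1) * x (IJ.2 - IJ.1 + 2) = 0) ∨
            x (IJ.2 - IJ.1) * aeval x (bordEnt ℤ none none) =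
              aeval x (bordEnt ℤ (some IJ.1) none) * aeval x (bordEnt ℤ none (some IJ.2)) ∨
            x (IJ.2 - IJ.1) * aeval x (bordEnt ℤ none none) =
              c * (aeval x (bordEnt ℤ (some IJ.1) none) * aeval x (bordEnt ℤ none (some IJ.2)))).card ≤ 4) :
    BordCoreNonvanishing p r := by
  classical
  intro hm a ha hper
  have hΦa : aeval a (bordPhi ℤ p r) = 0 :=
    (eval_perPoly_bordPoint_eq_zero_iff_bordPhi (by omega) a).mp hper
  have h5 := le_card_ne_zero_of_charP (σ := Fin 3) (ι := Fin 3 × Fin 3) (bordPhi ℤ p r)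
    (fun IJ => bordPsi ℤ p r IJ.1 IJ.2) (3 * p + r) (fun _ => 3 * p + r - 2)
    (bordPhi_isHomogeneous (R := ℤ) p r) (fun IJ => bordPsi_isHomogeneous (R := ℤ) p r hm IJ.1 IJ.2) hp 5
    (fun L _ _ _ w hw hΦw => five_le_card_aeval_bordPsi_ne_zero hp hr1 hr (hD L) w hw hΦw) a ha hΦa
  refine h5.trans (Finset.card_le_card fun IJ hIJ => ?_)
  simp only [Finset.mem_filter, Finset.mem_univ, true_and] at hIJ ⊢
  exact fun h0 => hIJ ((bordBlockValue_eq_zero_iff_bordPsi hm a IJ.1 IJ.2).mp h0)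

/-- **Good planes for ALL large `n`, from the death count.**  If for all primes `p ≥ p₀` and all
`1 ≤ r ≤ p - 3` the characteristic-`p` death count (DEATHS) holds, then `GoodPlane n` for all large `n` —
the registered `stub_goodPlanes` of `Lines/good_plane.lean`, unfolded (via `bordCoreNonvanishing_of_deaths`
and p3's `goodPlanes_of_bordCoreNonvanishing'`). [folklore] -/
theorem goodPlanes_of_deaths (p₀ : ℕ)
    (hD : ∀ p ≥ p₀, p.Prime → ∀ r : ℕ, 1 ≤ r → r + 3 ≤ p →
      ∀ (L : Type) [Field L] [CharP L p] [DecidableEq L] (c : L), c ≠ 0 → ∀ x : Fin 3 → L, x ≠ 0 →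
        (x 0 ^ 3 + x 1 ^ 3 + x 2 ^ 3 + 3 * (x 0 * x 1 * x 2) = 0 ∨ aeval x (bordEnt ℤ none none) = 0) →
        (Finset.univ.filter fun IJ : Fin 3 × Fin 3 =>
            (x (IJ.2 - IJ.1) = 0 ∨ x (IJ.2 - IJ.1) ^ 2 + x (IJ.2 - IJ.1 + 1) * x (IJ.2 - IJ.1 + 2) = 0) ∨
            x (IJ.2 - IJ.1) * aeval x (bordEnt ℤ none none) =
              aeval x (bordEnt ℤ (some IJ.1) none) * aeval x (bordEnt ℤ none (some IJ.2)) ∨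
            x (IJ.2 - IJ.1) * aeval x (bordEnt ℤ none none) =
              c * (aeval x (bordEnt ℤ (some IJ.1) none) * aeval x (bordEnt ℤ none (some IJ.2)))).card ≤ 4) :
    ∃ n₀ : ℕ, ∀ n ≥ n₀,
      ∃ w : Fin 3 → (Fin n × Fin n → ℂ), LinearIndependent ℂ w ∧
        ∀ a : Fin 3 → ℂ, a ≠ 0 →
          MvPolynomial.eval (∑ i, a i • w i) (perPoly (Fin n) ℂ) = 0 →
            n ^ 2 < 2 * (hess0 (transl (∑ i, a i • w i) (perPoly (Fin n) ℂ))).rank :=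
  goodPlanes_of_bordCoreNonvanishing'
    ⟨p₀, fun p hp hprime r hr1 hr =>
      bordCoreNonvanishing_of_deaths hprime hr1 hr (hD p hp hprime r hr1 hr)⟩

end Assembly

end Summit.ValiantsHypothesis.ValiantsHypothesis.Theorems.GrenetZeonHessianRankCodimTwo
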